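import Summits.BirchSwinnertonDyer.BirchSwinnertonDyer.Theorems.PrintCFramBottomClassIndexLawFiveLeBernoulliUnitsRoadC
import Summits.BirchSwinnertonDyer.BirchSwinnertonDyer.Theorems.PrintCFramBottomClassIndexLawFiveLeHerbrandLineCharactersDirichlet
import Literature.NumberTheory.GaloisRepresentations.TateLevelOneWildOdd
import HarnessLib

/-!
# Crux `PrintCFram.BottomClassIndexLawFiveLe` (stmt-BirchSwinnertonDyer-20372), line `eisenstein-resource-bdp-line` (registry v12, ROAD C,
# stub D `stub_lineDictionary`): THE BERNOULLI UNITS OF THE KRIZ–LI DATUM, part A — POINTWISE DIRICHLET AVATARS on `Γ_ℚ`: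
# `Teich(r₁ τ) = λ̃(χ_𝔣(τ))` for each of the four lift shapes, and `Teich(χ̄_p τ · r₂(τ)⁻¹) = (ω·λ⁻¹)~(χ_𝔣(τ))` — the avatar conjuncts
# `(ψᵢ τ̄ : ℚ_p) = χᵢ (modNCyclotomicCharacter ℚ fᵢ τ)` of `stub_lineDictionary`, up to the Galois-side descent through `Gal(L/ℚ)`
# (cell `bsd-print-cfram`, width seat `bsd-line-cfram-p1-w3` g4; THEOREMS ONLY, `--supports` 20372; BSD is not proved by any of this)

HONEST FRAMING. Nothing here is a statement about BSD; no stub of the skeleton is closed. Stub D of v12 (`stub_lineDictionary`) asks, for the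
odd lift `r₁` and the even lift `r₂` of a line character (`{r₁, r₂} = {r, rε}`, `r = b∘χ_m` or `χ̄_p·(b∘χ_m)⁻¹` by T1 p649783), for
`ψ₁ = Teich∘r₁`, `ψ₂ = Teich∘(χ̄_p r₂⁻¹)` (through `Gal(L/ℚ)`, `Gal(L′/ℚ)`) and PRIMITIVE `χ₁, χ₂` with the POINTWISE identities
`(ψᵢ(τ̄) : ℚ_p) = χᵢ(χ_{fᵢ}(τ))` for all `τ ∈ Γ_ℚ`. The Dirichlet side of these identities is evaluation bookkeeping: `Teich = ω` on
`(ℤ/p)ˣ` (§1), a lifted / primitive character evaluated at the cyclotomic character of its own level equals the original character at the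
cyclotomic character of the original level (§2, tree `unitsMap_modNCyclotomicCharacter_of_dvd`), and the lift relation of part III
(`λ↑ = ψ₁↑`, `ψ₁↑ε_K↑`, `ψ₁⁻¹↑ω↑`, `ψ₁⁻¹↑ω↑ε_K↑` at a common level `M`). The ONE Galois-side input is the pointwise avatar of the
quadratic character of `K''`: `Teich(ε τ) = ε_K(χ_d τ)` (`hεav`; D-gal, via Kronecker–Weber and part III's
`changeLevel_eq_of_forall_prime_apply_eq`).

* §1 `coe_teichmullerChar_eq_apply` (`Teich(u) = ω(u)` in `ℚ_p` for a Teichmüller `ω`), `coe_teichmullerChar_inv`, `coe_teichmullerChar_mul`,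
  `toZMod_teichmullerChar_apply`;
* §2 `changeLevel_apply_modNCyclotomicCharacter`, `primitiveCharacter_apply_modNCyclotomicCharacter`;
* §3 **`avatar_of_lift_psi`**, **`avatar_of_lift_psiEps`**, **`avatar_of_lift_psiInvOmega`**, **`avatar_of_lift_psiInvOmegaEps`**
  (`Teich(r₁ τ) = λ̃(χ_𝔣 τ)` for the four shapes of `r₁`), **`avatar_reflection_of_avatar`** (`Teich(χ̄_p τ · (r₂ τ)⁻¹) = (ω↑·λ↑⁻¹)~(χ_𝔣 τ)`
  from `Teich(r₂ τ) = λ(χ_n τ)`), `toZMod_teichmullerChar_apply` (the `toZMod` conjuncts).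

beyond-print theorem: NO. References: [Washington1997] §5.1 (Teichmüller character), Thm. 14.1; [KrizLi2019] §2 (p. 11); LEAD g9, v12 §1.
-/

set_option autoImplicit false
set_option linter.dupNamespace false

noncomputable section

open scoped Classical
open NumberField Field
open DirichletCharacter Literature.NumberTheory.LFunctions Literature.NumberTheory.EllipticCurves.KrizLi2019
  Literature.NumberTheory.EllipticCurves Literature.NumberTheory.GaloisRepresentations

namespace Summit.BirchSwinnertonDyer.BirchSwinnertonDyer.Theorems.PrintCFram.BernoulliUnits

open Summit.BirchSwinnertonDyer.BirchSwinnertonDyer.Theorems.PrintCFram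

variable {p : ℕ} [hp : Fact p.Prime]

/-! ## §1 `Teich = ω` on `(ℤ/p)ˣ`, read in `ℚ_p` -/

/-- **`Teich(u) = ω(u)` in `ℚ_p`** for the tree's Teichmüller character `Kato2004.teichmullerChar p : (ℤ/p)ˣ →* ℤ_pˣ` and ANY Dirichlet
character `ω` mod `p` with `KrizLi2019.IsTeichmullerCharacter ω` (`p` odd): both are `(p−1)`-th roots of unity congruent to `u`, and the
roots of unity of `ℚ_p` are pairwise incongruent (rigidity, w3 g3 `BernoulliIntegral.eq_one_of_pow_eq_one_of_norm_sub_one_lt`).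
[cite: Washington1997, §5.1 (ω(a) ≡ a mod p)] -/
theorem coe_teichmullerChar_eq_apply (hp2 : p ≠ 2) {ω : DirichletCharacter ℚ_[p] p} (hω : IsTeichmullerCharacter ω)
    (u : (ZMod p)ˣ) : (((Kato2004.teichmullerChar p u : ℤ_[p]ˣ) : ℤ_[p]) : ℚ_[p]) = ω (u : ZMod p) := by
  have hpp := hp.out
  set T : ℤ_[p]ˣ := Kato2004.teichmullerChar p u with hT
  -- `p ∤ u.val`
  have hpu : ¬ ((p : ℤ) ∣ (((u : ZMod p).val : ℕ) : ℤ)) := by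
    intro hd
    have h0 : ((((u : ZMod p).val : ℕ) : ℤ) : ZMod p) = 0 := (ZMod.intCast_zmod_eq_zero_iff_dvd _ p).mpr hd
    rw [Int.cast_natCast, ZMod.natCast_zmod_val] at h0
    exact u.ne_zero h0
  -- `‖T − u.val‖ < 1`
  have hT1 : ‖((T : ℤ_[p]) : ℚ_[p]) - (((u : ZMod p).val : ℕ) : ℚ_[p])‖ < 1 := by
    have hz : PadicInt.toZMod ((T : ℤ_[p]) - (((u : ZMod p).val : ℕ) : ℤ_[p])) = 0 := by
      rw [map_sub, hT, Kato2004.toZMod_teichmullerChar, map_natCast, ZMod.natCast_zmod_val, sub_self]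
    have hmem : (T : ℤ_[p]) - (((u : ZMod p).val : ℕ) : ℤ_[p]) ∈ RingHom.ker (PadicInt.toZMod : ℤ_[p] →+* ZMod p) :=
      (RingHom.mem_ker).mpr hz
    rw [PadicInt.ker_toZMod, IsLocalRing.mem_maximalIdeal, mem_nonunits_iff, PadicInt.isUnit_iff] at hmem
    have hlt := lt_of_le_of_ne (PadicInt.norm_le_one _) hmem
    rw [PadicInt.norm_def, PadicInt.coe_sub] at hlt
    push_cast at hlt
    exact hlt
  -- `‖ω u − u.val‖ < 1`
  have hω1 : ‖ω (u : ZMod p) - (((u : ZMod p).val : ℕ) : ℚ_[p])‖ < 1 := by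
    have h := hω _ hpu
    rw [Int.cast_natCast, ZMod.natCast_zmod_val] at h
    push_cast at h
    exact h
  -- both are `(p−1)`-th roots of unity
  have hTpow : ((T : ℤ_[p]) : ℚ_[p]) ^ (p - 1) = 1 := by
    rw [← PadicInt.coe_pow, ← Units.val_pow_eq_pow_val, hT, Kato2004.teichmullerChar_pow_sub_one, Units.val_one, PadicInt.coe_one]
  have hωpow : ω (u : ZMod p) ^ (p - 1) = 1 := by
    have h := apply_pow_sub_one_eq_one ω _ hpu
    rwa [Int.cast_natCast, ZMod.natCast_zmod_val] at h
  have hωne : ω (u : ZMod p) ≠ 0 := by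
    intro h0; rw [h0, zero_pow (Nat.sub_ne_zero_of_lt hpp.one_lt)] at hωpow; exact zero_ne_one hωpow
  have hωn : ‖ω (u : ZMod p)‖ = 1 := by
    have h := norm_apply_eq_one ω _ hpu
    rwa [Int.cast_natCast, ZMod.natCast_zmod_val] at h
  -- `ζ = T · ω(u)⁻¹` is a `(p−1)`-th root of unity congruent to `1`
  set ζ : ℚ_[p] := ((T : ℤ_[p]) : ℚ_[p]) * (ω (u : ZMod p))⁻¹ with hζ
  have hζpow : ζ ^ (p - 1) = 1 := by rw [hζ, mul_pow, inv_pow, hTpow, hωpow, inv_one, mul_one]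
  have hζ1 : ‖ζ - 1‖ < 1 := by
    have e : ζ - 1 = ((((T : ℤ_[p]) : ℚ_[p]) - (((u : ZMod p).val : ℕ) : ℚ_[p])) -
        (ω (u : ZMod p) - (((u : ZMod p).val : ℕ) : ℚ_[p]))) * (ω (u : ZMod p))⁻¹ := by
      rw [hζ]; field_simp; ring
    rw [e, norm_mul, norm_inv, hωn, inv_one, mul_one, sub_eq_add_neg]
    refine lt_of_le_of_lt (IsUltrametricDist.norm_add_le_max _ _) (max_lt hT1 ?_)
    rw [norm_neg]; exact hω1
  have hζeq : ζ = 1 :=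
    BernoulliIntegral.eq_one_of_pow_eq_one_of_norm_sub_one_lt hp2 (Nat.sub_ne_zero_of_lt hpp.one_lt) hζpow hζ1
  have : ((T : ℤ_[p]) : ℚ_[p]) = ω (u : ZMod p) := by
    have h := congrArg (· * ω (u : ZMod p)) hζeq
    simp only [hζ, inv_mul_cancel_right₀ hωne, one_mul] at h
    exact h
  exact this

/-- `Teich` of an inverse, read in `ℚ_p` (a unit of `ℤ_p` and its inverse cast to `ℚ_p`; cf. the tree's
`Rank1Residual.Additive.coe_units_inv_eq_inv`, not imported here to keep the import closure small). [folklore] -/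
theorem coe_teichmullerChar_inv (x : (ZMod p)ˣ) :
    (((Kato2004.teichmullerChar p x⁻¹ : ℤ_[p]ˣ) : ℤ_[p]) : ℚ_[p]) = ((((Kato2004.teichmullerChar p x : ℤ_[p]ˣ) : ℤ_[p]) : ℚ_[p]))⁻¹ := by
  rw [map_inv]
  apply eq_inv_of_mul_eq_one_right
  rw [← PadicInt.coe_mul, ← Units.val_mul, mul_inv_cancel, Units.val_one, PadicInt.coe_one]

/-- `Teich` of a product, read in `ℚ_p`. [folklore] -/
theorem coe_teichmullerChar_mul (x y : (ZMod p)ˣ) :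
    (((Kato2004.teichmullerChar p (x * y) : ℤ_[p]ˣ) : ℤ_[p]) : ℚ_[p]) =
      (((Kato2004.teichmullerChar p x : ℤ_[p]ˣ) : ℤ_[p]) : ℚ_[p]) * (((Kato2004.teichmullerChar p y : ℤ_[p]ˣ) : ℤ_[p]) : ℚ_[p]) := by
  rw [map_mul, Units.val_mul, PadicInt.coe_mul]

/-- The `toZMod` conjuncts of `stub_lineDictionary`: `toZMod (Teich x) = x`. [cite: Washington1997, §5.1] -/
theorem toZMod_teichmullerChar_apply (x : (ZMod p)ˣ) :
    PadicInt.toZMod ((Kato2004.teichmullerChar p x : ℤ_[p]ˣ) : ℤ_[p]) = (x : ZMod p) :=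
  Kato2004.toZMod_teichmullerChar p x

/-! ## §2 Characters evaluated at the cyclotomic character of their own level -/

section Cyclotomic

variable {n M : ℕ} [NeZero n] [NeZero M]

/-- **A lifted character at `χ_M` is the character at `χ_n`** (`n ∣ M`): `(changeLevel h X)(χ_M τ) = X(χ_n τ)`, because
`χ_n = unitsMap ∘ χ_M` (tree `unitsMap_modNCyclotomicCharacter_of_dvd`). [folklore] -/
theorem changeLevel_apply_modNCyclotomicCharacter (h : n ∣ M) (X : DirichletCharacter ℚ_[p] n) (τ : absoluteGaloisGroup ℚ) :
    changeLevel h X ((modNCyclotomicCharacter ℚ M τ : (ZMod M)ˣ) : ZMod M) =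
      X ((modNCyclotomicCharacter ℚ n τ : (ZMod n)ˣ) : ZMod n) := by
  rw [changeLevel_eq_cast_of_dvd X h, ← ZMod.unitsMap_val h, unitsMap_modNCyclotomicCharacter_of_dvd ℚ h]

/-- **The primitive character at `χ_𝔣` is the character at `χ_n`**: `X̃(χ_{𝔣(X)} τ) = X(χ_n τ)`. [folklore] -/
theorem primitiveCharacter_apply_modNCyclotomicCharacter (X : DirichletCharacter ℚ_[p] n) (τ : absoluteGaloisGroup ℚ) :
    (haveI : NeZero X.conductor := ⟨X.conductor_ne_zero⟩
    X.primitiveCharacter ((modNCyclotomicCharacter ℚ X.conductor τ : (ZMod X.conductor)ˣ) : ZMod X.conductor)) =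
      X ((modNCyclotomicCharacter ℚ n τ : (ZMod n)ˣ) : ZMod n) := by
  haveI : NeZero X.conductor := ⟨X.conductor_ne_zero⟩
  have h := changeLevel_apply_modNCyclotomicCharacter X.conductor_dvd_level X.primitiveCharacter τ
  rw [changeLevel_primitiveCharacter] at h
  exact h.symm

end Cyclotomic

/-! ## §3 Pointwise avatars of the four lifts and of the reflection character -/

section Avatars

variable {m d n M : ℕ} [NeZero m] [NeZero d] [NeZero n] [NeZero M]

/-- **Avatar, lift `λ ~ ψ₁`: `Teich(b(χ_m τ)) = λ̃(χ_𝔣 τ)`** (`r₁ = b∘χ_m`; `ψ₁(u) = Teich(b u)` is T1's `hψ₁`).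
[cite: Washington1997, §5.1 and Thm. 14.1] -/
theorem avatar_of_lift_psi (b : (ZMod m)ˣ →* (ZMod p)ˣ) {ψ₁ : DirichletCharacter ℚ_[p] m}
    (hψ₁ : ∀ u : (ZMod m)ˣ, ψ₁ (u : ZMod m) = (((Kato2004.teichmullerChar p (b u) : ℤ_[p]ˣ) : ℤ_[p]) : ℚ_[p]))
    (hn : n ∣ M) (hm : m ∣ M) (lam : DirichletCharacter ℚ_[p] n)
    (el : changeLevel hn lam = changeLevel hm ψ₁) (τ : absoluteGaloisGroup ℚ) :
    (((Kato2004.teichmullerChar p (b (modNCyclotomicCharacter ℚ m τ)) : ℤ_[p]ˣ) : ℤ_[p]) : ℚ_[p]) =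
      (haveI : NeZero lam.conductor := ⟨lam.conductor_ne_zero⟩
      lam.primitiveCharacter ((modNCyclotomicCharacter ℚ lam.conductor τ : (ZMod lam.conductor)ˣ) : ZMod lam.conductor)) := by
  rw [primitiveCharacter_apply_modNCyclotomicCharacter, ← changeLevel_apply_modNCyclotomicCharacter hn lam τ, el,
    changeLevel_apply_modNCyclotomicCharacter, hψ₁]

/-- **Avatar, lift `λ ~ ψ₁ε_K`: `Teich(b(χ_m τ)·ε(τ)) = λ̃(χ_𝔣 τ)`** (`r₁ = (b∘χ_m)·ε`; needs the pointwise avatar `hεav` of `ε`).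
[cite: Washington1997, §5.1 and Thm. 14.1] -/
theorem avatar_of_lift_psiEps (b : (ZMod m)ˣ →* (ZMod p)ˣ) {ψ₁ : DirichletCharacter ℚ_[p] m}
    (hψ₁ : ∀ u : (ZMod m)ˣ, ψ₁ (u : ZMod m) = (((Kato2004.teichmullerChar p (b u) : ℤ_[p]ˣ) : ℤ_[p]) : ℚ_[p]))
    (e : absoluteGaloisGroup ℚ →* (ZMod p)ˣ) {εK : DirichletCharacter ℚ_[p] d}
    (hεav : ∀ τ : absoluteGaloisGroup ℚ, (((Kato2004.teichmullerChar p (e τ) : ℤ_[p]ˣ) : ℤ_[p]) : ℚ_[p]) =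
      εK ((modNCyclotomicCharacter ℚ d τ : (ZMod d)ˣ) : ZMod d))
    (hn : n ∣ M) (hm : m ∣ M) (hd : d ∣ M) (lam : DirichletCharacter ℚ_[p] n)
    (el : changeLevel hn lam = changeLevel hm ψ₁ * changeLevel hd εK) (τ : absoluteGaloisGroup ℚ) :
    (((Kato2004.teichmullerChar p (b (modNCyclotomicCharacter ℚ m τ) * e τ) : ℤ_[p]ˣ) : ℤ_[p]) : ℚ_[p]) =
      (haveI : NeZero lam.conductor := ⟨lam.conductor_ne_zero⟩
      lam.primitiveCharacter ((modNCyclotomicCharacter ℚ lam.conductor τ : (ZMod lam.conductor)ˣ) : ZMod lam.conductor)) := by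
  rw [primitiveCharacter_apply_modNCyclotomicCharacter, ← changeLevel_apply_modNCyclotomicCharacter hn lam τ, el, MulChar.mul_apply,
    changeLevel_apply_modNCyclotomicCharacter, changeLevel_apply_modNCyclotomicCharacter, hψ₁, ← hεav, coe_teichmullerChar_mul]

/-- **Avatar, lift `λ ~ ψ₁⁻¹ω`: `Teich(χ̄_p(τ)·b(χ_m τ)⁻¹) = λ̃(χ_𝔣 τ)`** (`r₁ = χ̄_p·(b∘χ_m)⁻¹`, the line character of the QUOTIENT).
[cite: Washington1997, §5.1 and Thm. 14.1] -/
theorem avatar_of_lift_psiInvOmega (hp2 : p ≠ 2) (b : (ZMod m)ˣ →* (ZMod p)ˣ) {ψ₁ : DirichletCharacter ℚ_[p] m}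
    (hψ₁ : ∀ u : (ZMod m)ˣ, ψ₁ (u : ZMod m) = (((Kato2004.teichmullerChar p (b u) : ℤ_[p]ˣ) : ℤ_[p]) : ℚ_[p]))
    {ω : DirichletCharacter ℚ_[p] p} (hω : IsTeichmullerCharacter ω)
    (hn : n ∣ M) (hm : m ∣ M) (hpM : p ∣ M) (lam : DirichletCharacter ℚ_[p] n)
    (el : changeLevel hn lam = changeLevel hm ψ₁⁻¹ * changeLevel hpM ω) (τ : absoluteGaloisGroup ℚ) :
    (((Kato2004.teichmullerChar p (modNCyclotomicCharacter ℚ p τ * (b (modNCyclotomicCharacter ℚ m τ))⁻¹) : ℤ_[p]ˣ) : ℤ_[p]) : ℚ_[p]) =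
      (haveI : NeZero lam.conductor := ⟨lam.conductor_ne_zero⟩
      lam.primitiveCharacter ((modNCyclotomicCharacter ℚ lam.conductor τ : (ZMod lam.conductor)ˣ) : ZMod lam.conductor)) := by
  rw [primitiveCharacter_apply_modNCyclotomicCharacter, ← changeLevel_apply_modNCyclotomicCharacter hn lam τ, el, MulChar.mul_apply,
    changeLevel_apply_modNCyclotomicCharacter, changeLevel_apply_modNCyclotomicCharacter, MulChar.inv_apply_eq_inv', hψ₁,
    ← coe_teichmullerChar_eq_apply hp2 hω, coe_teichmullerChar_mul, coe_teichmullerChar_inv, mul_comm]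

/-- **Avatar, lift `λ ~ ψ₁⁻¹ωε_K`: `Teich(χ̄_p(τ)·b(χ_m τ)⁻¹·ε(τ)) = λ̃(χ_𝔣 τ)`** (`r₁ = χ̄_p·(b∘χ_m)⁻¹·ε`).
[cite: Washington1997, §5.1 and Thm. 14.1] -/
theorem avatar_of_lift_psiInvOmegaEps (hp2 : p ≠ 2) (b : (ZMod m)ˣ →* (ZMod p)ˣ) {ψ₁ : DirichletCharacter ℚ_[p] m}
    (hψ₁ : ∀ u : (ZMod m)ˣ, ψ₁ (u : ZMod m) = (((Kato2004.teichmullerChar p (b u) : ℤ_[p]ˣ) : ℤ_[p]) : ℚ_[p]))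
    (e : absoluteGaloisGroup ℚ →* (ZMod p)ˣ) {εK : DirichletCharacter ℚ_[p] d}
    (hεav : ∀ τ : absoluteGaloisGroup ℚ, (((Kato2004.teichmullerChar p (e τ) : ℤ_[p]ˣ) : ℤ_[p]) : ℚ_[p]) =
      εK ((modNCyclotomicCharacter ℚ d τ : (ZMod d)ˣ) : ZMod d))
    {ω : DirichletCharacter ℚ_[p] p} (hω : IsTeichmullerCharacter ω)
    (hn : n ∣ M) (hm : m ∣ M) (hd : d ∣ M) (hpM : p ∣ M) (lam : DirichletCharacter ℚ_[p] n)
    (el : changeLevel hn lam = changeLevel hm ψ₁⁻¹ * changeLevel hpM ω * changeLevel hd εK) (τ : absoluteGaloisGroup ℚ) :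
    (((Kato2004.teichmullerChar p (modNCyclotomicCharacter ℚ p τ * (b (modNCyclotomicCharacter ℚ m τ))⁻¹ * e τ) : ℤ_[p]ˣ) :
        ℤ_[p]) : ℚ_[p]) =
      (haveI : NeZero lam.conductor := ⟨lam.conductor_ne_zero⟩
      lam.primitiveCharacter ((modNCyclotomicCharacter ℚ lam.conductor τ : (ZMod lam.conductor)ˣ) : ZMod lam.conductor)) := by
  rw [primitiveCharacter_apply_modNCyclotomicCharacter, ← changeLevel_apply_modNCyclotomicCharacter hn lam τ, el, MulChar.mul_apply,
    MulChar.mul_apply, changeLevel_apply_modNCyclotomicCharacter, changeLevel_apply_modNCyclotomicCharacter,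
    changeLevel_apply_modNCyclotomicCharacter, MulChar.inv_apply_eq_inv', hψ₁, ← coe_teichmullerChar_eq_apply hp2 hω, ← hεav,
    coe_teichmullerChar_mul, coe_teichmullerChar_mul, coe_teichmullerChar_inv]
  ring

/-- **Avatar of the reflection character `ω r₂⁻¹`**: if `Teich(r₂ τ) = λ(χ_n τ)` pointwise (the EVEN lift's avatar at level `n`,
`avatar_level_of_lift_*` below), then `Teich(χ̄_p(τ)·r₂(τ)⁻¹) = X̃(χ_𝔣 τ)` for `X = ω↑·λ↑⁻¹` (level `n·p`) — the avatar conjunct of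
`ψ₂`, `χ₂` in `stub_lineDictionary`. [cite: Washington1997, §5.1 and Thm. 14.1] -/
theorem avatar_reflection_of_avatar (hp2 : p ≠ 2) {ω : DirichletCharacter ℚ_[p] p} (hω : IsTeichmullerCharacter ω)
    (lam : DirichletCharacter ℚ_[p] n) (r₂ : absoluteGaloisGroup ℚ →* (ZMod p)ˣ)
    (hav : ∀ τ : absoluteGaloisGroup ℚ, (((Kato2004.teichmullerChar p (r₂ τ) : ℤ_[p]ˣ) : ℤ_[p]) : ℚ_[p]) =
      lam ((modNCyclotomicCharacter ℚ n τ : (ZMod n)ˣ) : ZMod n)) (τ : absoluteGaloisGroup ℚ) :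
    (haveI : NeZero (n * p) := ⟨Nat.mul_ne_zero (NeZero.ne n) hp.out.ne_zero⟩
    let X : DirichletCharacter ℚ_[p] (n * p) := changeLevel (dvd_mul_left p n) ω * (changeLevel (dvd_mul_right n p) lam)⁻¹
    haveI : NeZero X.conductor := ⟨X.conductor_ne_zero⟩
    (((Kato2004.teichmullerChar p (modNCyclotomicCharacter ℚ p τ * (r₂ τ)⁻¹) : ℤ_[p]ˣ) : ℤ_[p]) : ℚ_[p]) =
      X.primitiveCharacter ((modNCyclotomicCharacter ℚ X.conductor τ : (ZMod X.conductor)ˣ) : ZMod X.conductor)) := by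
  haveI : NeZero (n * p) := ⟨Nat.mul_ne_zero (NeZero.ne n) hp.out.ne_zero⟩
  simp only []
  rw [primitiveCharacter_apply_modNCyclotomicCharacter, MulChar.mul_apply, MulChar.inv_apply_eq_inv',
    changeLevel_apply_modNCyclotomicCharacter, changeLevel_apply_modNCyclotomicCharacter, ← hav,
    ← coe_teichmullerChar_eq_apply hp2 hω, coe_teichmullerChar_mul, coe_teichmullerChar_inv]

/-- **The lift's avatar at level `n`** (input shape of `avatar_reflection_of_avatar`), shape `λ ~ ψ₁`: `Teich(b(χ_m τ)) = λ(χ_n τ)`.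
[cite: Washington1997, §5.1] -/
theorem avatar_level_of_lift_psi (b : (ZMod m)ˣ →* (ZMod p)ˣ) {ψ₁ : DirichletCharacter ℚ_[p] m}
    (hψ₁ : ∀ u : (ZMod m)ˣ, ψ₁ (u : ZMod m) = (((Kato2004.teichmullerChar p (b u) : ℤ_[p]ˣ) : ℤ_[p]) : ℚ_[p]))
    (hn : n ∣ M) (hm : m ∣ M) (lam : DirichletCharacter ℚ_[p] n)
    (el : changeLevel hn lam = changeLevel hm ψ₁) (τ : absoluteGaloisGroup ℚ) :
    (((Kato2004.teichmullerChar p (b (modNCyclotomicCharacter ℚ m τ)) : ℤ_[p]ˣ) : ℤ_[p]) : ℚ_[p]) =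
      lam ((modNCyclotomicCharacter ℚ n τ : (ZMod n)ˣ) : ZMod n) := by
  rw [← changeLevel_apply_modNCyclotomicCharacter hn lam τ, el, changeLevel_apply_modNCyclotomicCharacter, hψ₁]

/-- Shape `λ ~ ψ₁ε_K` at level `n`: `Teich(b(χ_m τ)·ε(τ)) = λ(χ_n τ)`. [cite: Washington1997, §5.1] -/
theorem avatar_level_of_lift_psiEps (b : (ZMod m)ˣ →* (ZMod p)ˣ) {ψ₁ : DirichletCharacter ℚ_[p] m}
    (hψ₁ : ∀ u : (ZMod m)ˣ, ψ₁ (u : ZMod m) = (((Kato2004.teichmullerChar p (b u) : ℤ_[p]ˣ) : ℤ_[p]) : ℚ_[p]))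
    (e : absoluteGaloisGroup ℚ →* (ZMod p)ˣ) {εK : DirichletCharacter ℚ_[p] d}
    (hεav : ∀ τ : absoluteGaloisGroup ℚ, (((Kato2004.teichmullerChar p (e τ) : ℤ_[p]ˣ) : ℤ_[p]) : ℚ_[p]) =
      εK ((modNCyclotomicCharacter ℚ d τ : (ZMod d)ˣ) : ZMod d))
    (hn : n ∣ M) (hm : m ∣ M) (hd : d ∣ M) (lam : DirichletCharacter ℚ_[p] n)
    (el : changeLevel hn lam = changeLevel hm ψ₁ * changeLevel hd εK) (τ : absoluteGaloisGroup ℚ) :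
    (((Kato2004.teichmullerChar p (b (modNCyclotomicCharacter ℚ m τ) * e τ) : ℤ_[p]ˣ) : ℤ_[p]) : ℚ_[p]) =
      lam ((modNCyclotomicCharacter ℚ n τ : (ZMod n)ˣ) : ZMod n) := by
  rw [← changeLevel_apply_modNCyclotomicCharacter hn lam τ, el, MulChar.mul_apply, changeLevel_apply_modNCyclotomicCharacter,
    changeLevel_apply_modNCyclotomicCharacter, hψ₁, ← hεav, coe_teichmullerChar_mul]

/-- Shape `λ ~ ψ₁⁻¹ω` at level `n`: `Teich(χ̄_p(τ)·b(χ_m τ)⁻¹) = λ(χ_n τ)`. [cite: Washington1997, §5.1] -/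
theorem avatar_level_of_lift_psiInvOmega (hp2 : p ≠ 2) (b : (ZMod m)ˣ →* (ZMod p)ˣ) {ψ₁ : DirichletCharacter ℚ_[p] m}
    (hψ₁ : ∀ u : (ZMod m)ˣ, ψ₁ (u : ZMod m) = (((Kato2004.teichmullerChar p (b u) : ℤ_[p]ˣ) : ℤ_[p]) : ℚ_[p]))
    {ω : DirichletCharacter ℚ_[p] p} (hω : IsTeichmullerCharacter ω)
    (hn : n ∣ M) (hm : m ∣ M) (hpM : p ∣ M) (lam : DirichletCharacter ℚ_[p] n)
    (el : changeLevel hn lam = changeLevel hm ψ₁⁻¹ * changeLevel hpM ω) (τ : absoluteGaloisGroup ℚ) :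
    (((Kato2004.teichmullerChar p (modNCyclotomicCharacter ℚ p τ * (b (modNCyclotomicCharacter ℚ m τ))⁻¹) : ℤ_[p]ˣ) : ℤ_[p]) : ℚ_[p]) =
      lam ((modNCyclotomicCharacter ℚ n τ : (ZMod n)ˣ) : ZMod n) := by
  rw [← changeLevel_apply_modNCyclotomicCharacter hn lam τ, el, MulChar.mul_apply, changeLevel_apply_modNCyclotomicCharacter,
    changeLevel_apply_modNCyclotomicCharacter, MulChar.inv_apply_eq_inv', hψ₁, ← coe_teichmullerChar_eq_apply hp2 hω,
    coe_teichmullerChar_mul, coe_teichmullerChar_inv, mul_comm]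

/-- Shape `λ ~ ψ₁⁻¹ωε_K` at level `n`: `Teich(χ̄_p(τ)·b(χ_m τ)⁻¹·ε(τ)) = λ(χ_n τ)`. [cite: Washington1997, §5.1] -/
theorem avatar_level_of_lift_psiInvOmegaEps (hp2 : p ≠ 2) (b : (ZMod m)ˣ →* (ZMod p)ˣ) {ψ₁ : DirichletCharacter ℚ_[p] m}
    (hψ₁ : ∀ u : (ZMod m)ˣ, ψ₁ (u : ZMod m) = (((Kato2004.teichmullerChar p (b u) : ℤ_[p]ˣ) : ℤ_[p]) : ℚ_[p]))
    (e : absoluteGaloisGroup ℚ →* (ZMod p)ˣ) {εK : DirichletCharacter ℚ_[p] d}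
    (hεav : ∀ τ : absoluteGaloisGroup ℚ, (((Kato2004.teichmullerChar p (e τ) : ℤ_[p]ˣ) : ℤ_[p]) : ℚ_[p]) =
      εK ((modNCyclotomicCharacter ℚ d τ : (ZMod d)ˣ) : ZMod d))
    {ω : DirichletCharacter ℚ_[p] p} (hω : IsTeichmullerCharacter ω)
    (hn : n ∣ M) (hm : m ∣ M) (hd : d ∣ M) (hpM : p ∣ M) (lam : DirichletCharacter ℚ_[p] n)
    (el : changeLevel hn lam = changeLevel hm ψ₁⁻¹ * changeLevel hpM ω * changeLevel hd εK) (τ : absoluteGaloisGroup ℚ) :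
    (((Kato2004.teichmullerChar p (modNCyclotomicCharacter ℚ p τ * (b (modNCyclotomicCharacter ℚ m τ))⁻¹ * e τ) : ℤ_[p]ˣ) :
        ℤ_[p]) : ℚ_[p]) = lam ((modNCyclotomicCharacter ℚ n τ : (ZMod n)ˣ) : ZMod n) := by
  rw [← changeLevel_apply_modNCyclotomicCharacter hn lam τ, el, MulChar.mul_apply, MulChar.mul_apply,
    changeLevel_apply_modNCyclotomicCharacter, changeLevel_apply_modNCyclotomicCharacter, changeLevel_apply_modNCyclotomicCharacter,
    MulChar.inv_apply_eq_inv', hψ₁, ← coe_teichmullerChar_eq_apply hp2 hω, ← hεav, coe_teichmullerChar_mul, coe_teichmullerChar_mul,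
    coe_teichmullerChar_inv]
  ring

end Avatars

end Summit.BirchSwinnertonDyer.BirchSwinnertonDyer.Theorems.PrintCFram.BernoulliUnits

end
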